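import Summits.SmoothPoincare4.SmoothPoincare4.Theorems.WeakReductionDescentDependentTripleGenusThreeStandardAnnularChartPushoffAux1
import Summits.SmoothPoincare4.SmoothPoincare4.Theorems.WeakReductionDescentDependentTripleGenusThreeStandardRoundCircleCurve
import Literature.Topology.FourManifolds.WeaklyReducibleTrisections
import Literature.Topology.FourManifolds.TrisectionCentralSurfaceMarking
import Literature.Topology.FourManifolds.BoundaryOrientation
import Literature.Topology.FourManifolds.NormalFramingOfCircleGeneral
import Literature.Topology.FourManifolds.SphereTubeOfFraming
import Literature.Geometry.Manifold.SmoothEmbeddingInverse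
import HarnessLib

/-!
# Crux `WeakReductionDescent.DependentTripleGenusThreeStandard` (stmt-SmoothPoincare4-18000), line
# `Sketch`: helper `helper_exists_annularChart_pushoff` — push-offs of curves of the central
# surface through an annular chart

Helper file (`--supports stmt-SmoothPoincare4-18000`) of the registered skeleton
`Cruxes/DependentTripleGenusThreeStandard/Lines/Sketch.lean`, proving VERBATIM its registered
helper `helper_exists_annularChart_pushoff`, the producer side of the landed stub
`stub_boundsDisc_of_annularChart`: for a Gay–Kirby trisection `T` of an ORIENTABLE smooth
`4`-manifold `M`, every curve `c` of the central surface `F = centralSurfaceSet T` (a smoothly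
embedded circle) and every open `U ⊇ c`, there is a disjoint parallel copy `c′ ⊆ U` of `c`,
namely the second round circle of an annular chart `ψ : ℝ² → M` of `F` (smooth, injective and
immersive INTO `M` on an open round annulus, with image in `F`) whose first round circle is
`c` — the push-offs used throughout Aranda–Zupan (2025), §§3, 7 ("a compressing disc bounded by
`c` yields one bounded by a disjoint parallel copy").

Proof (everything proved in the tree):

* clause (iii) of `IsGKTrisection` for the pair `(0, 1)`: a compact `3`-manifold with boundary
  `H` and a smooth embedding `h : H → M` with `h(∂H) = F`; `H` is orientable since `M` is
  (`IsGKTrisection.isOrientable_of_clause_iii`), hence so is the abstract closed surface `∂H`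
  (`BoundaryManifold.boundaryData 2 H`, `BoundaryData.orientation`: Hirsch §4.4);
* the circle `γ` of `c` pulls back along `j = h ∘ incl` to a smoothly embedded circle `γ_N` of
  `∂H` (inverses of smooth embeddings are smooth on their ranges,
  `Literature.Geometry.Manifold.contMDiffOn_invFun_range`; immersivity by the chain rule);
* an embedded circle in an oriented surface has a normal framing
  (`exists_normalFraming_of_smoothOrientation`, Hirsch Ch. 4 §4 Ex. 2) and hence a product
  neighbourhood `ν : 𝕊¹ × ℝ → ∂H`, `ν (u, 0) = γ_N u`
  (`exists_isSmoothEmbedding_tube_of_isSmoothAlong`, Kosinski III (2.2)): the curve is two-sided;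
* polar coordinates turn the tube into an annular chart `φ` of `∂H`
  (`helper_annularChart_of_circleTube`, Aux1), and `ψ = j ∘ φ` is the annular chart INTO `M`
  (smooth, injective, immersive: `injective_mfderiv_of_isSmoothEmbedding` for `h`, `incl`);
* by compactness of the circle a thin tube `𝕊¹ × (-ε, ε)` stays inside `j⁻¹ U`; with `r₀ = 1`,
  `r₁ = 1 + δ` (`0 < δ < ε`, `δ ≤ 1/4`), `r_lo = 1/2`, `r_hi = 3/2`, the circle `ψ(r₀ 𝕊¹)` is
  `c` and `c′ = ψ(r₁ 𝕊¹) ⊆ U` is a curve of `F` (`helper_isCurve_roundCircle_of_annularChart`,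
  `RoundCircleCurve.lean`: immersion criterion on the compact circle) disjoint from `c`.

No definitions, no named facts.

References: R. Aranda, A. Zupan, arXiv:2503.04607 (2025), §2 (p. 3), §7 (p. 24);
M. W. Hirsch, *Differential Topology* (1976), §4.4 (p. 103), Ch. 4 §4 Ex. 2, Ch. 4 §5 Thm. 5.1,
Ch. 1 §3 Thm. 3.1; A. Kosinski, *Differential Manifolds* (1993), III (2.2)–(2.3);
D. Gay, R. Kirby, Geom. Topol. 20 (2016), Def. 1.
-/

-- the registered namespace `Summit.SmoothPoincare4.SmoothPoincare4.Theorems…` repeats a component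
set_option linter.dupNamespace false

noncomputable section

open scoped Manifold ContDiff Topology
open Set Function Metric Module
open Literature.Topology.FourManifolds
open Literature.Topology.FourManifolds.Trisection

namespace Summit.SmoothPoincare4.SmoothPoincare4.Theorems

/-- **Push-offs of curves of the central surface through an annular chart** (REGISTERED helper
`helper_exists_annularChart_pushoff` of the skeleton `Lines/Sketch.lean` of the crux
`DependentTripleGenusThreeStandard`; Aranda–Zupan 2025, §§3, 7).  See the module docstring for
the statement and the proof.
[cite: ArandaZupan2025, §2 (p. 3) and §7 (p. 24)]
[cite: HirschDT1976, §4.4 p. 103, Ch. 4 §4 Exercise 2 (p. 108), Ch. 4 §5 Thm. 5.1]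
[cite: Kosinski1993, Ch. III §2, Thm. (2.2) and Cor. (2.3)] -/
theorem helper_exists_annularChart_pushoff :
    ∀ (M : Type) [TopologicalSpace M] [T2Space M] [SecondCountableTopology M]
      [ChartedSpace (EuclideanSpace ℝ (Fin 4)) M] [IsManifold (𝓡 4) ∞ M],
      IsOrientable (𝓡 4) M →
      ∀ (g : ℕ) (k : Fin 3 → ℕ) (T : Fin 3 → Set M), IsGKTrisection M g k T →
      ∀ (c : Set M), IsCurve T c → ∀ (U : Set M), IsOpen U → c ⊆ U →
      ∃ c' : Set M, IsCurve T c' ∧ Disjoint c c' ∧ c' ⊆ U ∧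
        ∃ (ψ : EuclideanSpace ℝ (Fin 2) → M) (rlo r₀ r₁ rhi : ℝ),
        0 < r₀ ∧ 0 < r₁ ∧ rlo < r₀ ∧ rlo < r₁ ∧ r₀ < rhi ∧ r₁ < rhi ∧
        ContMDiffOn (𝓡 2) (𝓡 4) ∞ ψ {x | rlo < ‖x‖ ∧ ‖x‖ < rhi} ∧
        Set.InjOn ψ {x | rlo < ‖x‖ ∧ ‖x‖ < rhi} ∧
        (∀ x : EuclideanSpace ℝ (Fin 2), rlo < ‖x‖ → ‖x‖ < rhi →
          Function.Injective (mfderiv (𝓡 2) (𝓡 4) ψ x)) ∧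
        ψ '' {x | rlo < ‖x‖ ∧ ‖x‖ < rhi} ⊆ centralSurfaceSet T ∧
        (Set.range fun x : Metric.sphere (0 : EuclideanSpace ℝ (Fin 2)) 1 =>
          ψ (r₀ • (x : EuclideanSpace ℝ (Fin 2)))) = c ∧
        (Set.range fun x : Metric.sphere (0 : EuclideanSpace ℝ (Fin 2)) 1 =>
          ψ (r₁ • (x : EuclideanSpace ℝ (Fin 2)))) = c' := by
  intro M _ _ _ _ _ ho g k T hT c hc U hU hcU
  haveI : Fact (finrank ℝ (EuclideanSpace ℝ (Fin 2)) = 1 + 1) := ⟨finrank_euclideanSpace_fin⟩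
  obtain ⟨hcF, γ, hγ, hγc⟩ := hc
  -- clause (iii) for the pair `(0, 1)`: the handlebody `h(H)` with `h(∂H) = F`
  have h01 : (0 : Fin 3) ≠ 1 := by decide
  obtain ⟨H, _, _, h, hM, hHc, -, -, hh, hrange, hbd⟩ := hT.2.2 0 1 h01
  haveI := hM
  haveI := hHc
  have hF : centralSurfaceSet T = h '' (𝓡∂ 3).boundary H := hbd.symm
  -- `H` is orientable since `M` is
  obtain ⟨oH⟩ := hT.isOrientable_of_clause_iii ho h01 h hh hrange hbd
  -- the curve sits in `h(∂H)`
  set x₀ : Metric.sphere (0 : EuclideanSpace ℝ (Fin 2)) 1 :=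
    ⟨EuclideanSpace.single 0 1, by simp⟩ with hx₀_def
  haveI : Nonempty (Metric.sphere (0 : EuclideanSpace ℝ (Fin 2)) 1) := ⟨x₀⟩
  have hγc' : ∀ u, γ u ∈ c := fun u => by rw [← hγc]; exact mem_range_self u
  have hγF : ∀ u, γ u ∈ h '' (𝓡∂ 3).boundary H := fun u => by rw [← hF]; exact hcF (hγc' u)
  haveI : Nonempty H := by
    obtain ⟨y, -, -⟩ := hγF x₀
    exact ⟨y⟩
  haveI : T2Space H := hh.isEmbedding.t2Space
  -- the abstract closed oriented surface `∂H`
  set bd : BoundaryData (𝓡∂ 3) H (𝓡 2) := BoundaryManifold.boundaryData 2 H with hbd_def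
  haveI : CompactSpace bd.carrier := bd.compactSpace_carrier
  haveI : T2Space bd.carrier := bd.isSmoothEmbedding.isEmbedding.t2Space
  haveI : Nonempty bd.carrier := by
    obtain ⟨y, hy, -⟩ := hγF x₀
    have hy' : y ∈ range bd.incl := by rw [bd.range_incl]; exact hy
    obtain ⟨n, -⟩ := hy'
    exact ⟨n⟩
  set oN : SmoothOrientation (𝓡 2) bd.carrier := bd.orientation oH with hoN_def
  -- the embedding `j = h ∘ incl : ∂H → M` onto `F`
  set j : bd.carrier → M := fun y => h (bd.incl y) with hj_def
  have hjs : ContMDiff (𝓡 2) (𝓡 4) ∞ j := hh.contMDiff.comp bd.isSmoothEmbedding.contMDiff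
  have hjinj : Injective j := hh.isEmbedding.injective.comp bd.injective_incl
  have hjimm : ∀ y, Injective (mfderiv (𝓡 2) (𝓡 4) j y) := by
    intro y
    have h2 : MDifferentiableAt (𝓡 2) (𝓡∂ 3) bd.incl y :=
      (bd.isSmoothEmbedding.contMDiff y).mdifferentiableAt (by simp)
    have h3 : MDifferentiableAt (𝓡∂ 3) (𝓡 4) h (bd.incl y) :=
      (hh.contMDiff _).mdifferentiableAt (by simp)
    rw [show j = h ∘ bd.incl from rfl, mfderiv_comp y h3 h2]
    exact (injective_mfderiv_of_isSmoothEmbedding hh (by simp) _).comp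
      (injective_mfderiv_of_isSmoothEmbedding bd.isSmoothEmbedding (by simp) _)
  have hjF : ∀ y, j y ∈ centralSurfaceSet T := fun y => by
    rw [hF]; exact ⟨bd.incl y, bd.incl_mem_boundary y, rfl⟩
  have hjU : IsOpen (j ⁻¹' U) := hU.preimage hjs.continuous
  -- the circle pulled back to `∂H`
  have hinvh : ContMDiffOn (𝓡 4) (𝓡∂ 3) ∞ (invFun h) (range h) :=
    Literature.Geometry.Manifold.contMDiffOn_invFun_range hh
  have hinvi : ContMDiffOn (𝓡∂ 3) (𝓡 2) ∞ (invFun bd.incl) (range bd.incl) :=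
    Literature.Geometry.Manifold.contMDiffOn_invFun_range bd.isSmoothEmbedding
  have hγH : ∀ u, γ u ∈ range h := fun u => by
    obtain ⟨y, -, hy⟩ := hγF u
    exact ⟨y, hy⟩
  have hhγ : ∀ u, h (invFun h (γ u)) = γ u := fun u => invFun_eq (hγH u)
  have hγbd : ∀ u, invFun h (γ u) ∈ range bd.incl := fun u => by
    rw [bd.range_incl]
    obtain ⟨y, hy, hyu⟩ := hγF u
    have : invFun h (γ u) = y := hh.isEmbedding.injective (by rw [hhγ u, hyu])
    rw [this]; exact hy
  set γN : Metric.sphere (0 : EuclideanSpace ℝ (Fin 2)) 1 → bd.carrier :=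
    fun u => invFun bd.incl (invFun h (γ u)) with hγN_def
  have hjγN : ∀ u, j (γN u) = γ u := fun u => by
    show h (bd.incl (invFun bd.incl (invFun h (γ u)))) = γ u
    rw [invFun_eq (hγbd u), hhγ u]
  have hγNs : ContMDiff (𝓡 1) (𝓡 2) ∞ γN :=
    hinvi.comp_contMDiff (hinvh.comp_contMDiff hγ.contMDiff hγH) hγbd
  have hγNinj : Injective γN := fun u v huv =>
    hγ.isEmbedding.injective (by rw [← hjγN u, ← hjγN v, huv])
  have hγNimm : ∀ u, Injective (mfderiv (𝓡 1) (𝓡 2) γN u) := by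
    intro u
    have h1 : MDifferentiableAt (𝓡 1) (𝓡 2) γN u := (hγNs u).mdifferentiableAt (by simp)
    have h2 : MDifferentiableAt (𝓡 2) (𝓡 4) j (γN u) := (hjs _).mdifferentiableAt (by simp)
    have hγeq : γ = j ∘ γN := funext fun u => (hjγN u).symm
    have key := injective_mfderiv_of_isSmoothEmbedding hγ (by simp) u
    rw [hγeq, mfderiv_comp u h2 h1] at key
    have key' : Injective (⇑(mfderiv (𝓡 2) (𝓡 4) j (γN u)) ∘
        ⇑(mfderiv (𝓡 1) (𝓡 2) γN u)) := key
    exact key'.of_comp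
  -- two-sidedness: a normal framing of the circle in the oriented surface, and its tube
  obtain ⟨Nf, hNf, hbij⟩ := exists_normalFraming_of_smoothOrientation (m := 1) oN hγNs hγNimm
  obtain ⟨ν, hν, -, hν0⟩ :=
    exists_isSmoothEmbedding_tube_of_isSmoothAlong (IM := 𝓡 1) (F := EuclideanSpace ℝ (Fin 1))
      hγNs hγNinj hNf hbij
  -- the annular chart of the tube (Aux1)
  obtain ⟨φ, hφs, hφinj, hφimm, hφr⟩ := helper_annularChart_of_circleTube bd.carrier ν hν
  -- a thin tube stays inside `j ⁻¹ U`
  have hW0 : ∀ u : Metric.sphere (0 : EuclideanSpace ℝ (Fin 2)) 1, ν (u, 0) ∈ j ⁻¹' U :=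
    fun u => by
    show j (ν (u, 0)) ∈ U
    rw [hν0 u, hjγN u]
    exact hcU (hγc' u)
  have hev : ∀ᶠ t in 𝓝 (0 : EuclideanSpace ℝ (Fin 1)),
      ∀ u ∈ (univ : Set (Metric.sphere (0 : EuclideanSpace ℝ (Fin 2)) 1)), ν (u, t) ∈ j ⁻¹' U := by
    refine isCompact_univ.eventually_forall_of_forall_eventually fun u _ => ?_
    have hcont : Continuous fun z : EuclideanSpace ℝ (Fin 1) ×
        Metric.sphere (0 : EuclideanSpace ℝ (Fin 2)) 1 => ν (z.2, z.1) :=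
      hν.isEmbedding.continuous.comp (continuous_snd.prodMk continuous_fst)
    exact hcont.continuousAt.eventually_mem (hjU.mem_nhds (hW0 u))
  obtain ⟨ε, hε, hεU⟩ := Metric.eventually_nhds_iff.1 hev
  -- radii
  set δ : ℝ := min (ε / 2) (1 / 4) with hδ_def
  have hδpos : 0 < δ := lt_min (half_pos hε) (by norm_num)
  have hδε : δ < ε := (min_le_left _ _).trans_lt (half_lt_self hε)
  have hδ4 : δ ≤ 1 / 4 := min_le_right _ _
  set e₁ : EuclideanSpace ℝ (Fin 1) := EuclideanSpace.single (0 : Fin 1) (1 : ℝ) with he₁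
  -- the annular chart into `M`
  set ψ : EuclideanSpace ℝ (Fin 2) → M := fun x => j (φ x) with hψ_def
  set A : Set (EuclideanSpace ℝ (Fin 2)) := {x | 1 / 2 < ‖x‖ ∧ ‖x‖ < 3 / 2} with hA_def
  have hA0 : A ⊆ {x | x ≠ 0} := fun x hx h0 => by
    have : (1 : ℝ) / 2 < ‖x‖ := hx.1
    rw [h0, norm_zero] at this
    linarith
  have hAo : IsOpen A :=
    (isOpen_lt continuous_const continuous_norm).inter (isOpen_lt continuous_norm continuous_const)
  have hψs : ContMDiffOn (𝓡 2) (𝓡 4) ∞ ψ A := hjs.comp_contMDiffOn (hφs.mono hA0)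
  have hψinj : InjOn ψ A := fun x hx y hy hxy => hφinj (hA0 hx) (hA0 hy) (hjinj hxy)
  have hψimm : ∀ x : EuclideanSpace ℝ (Fin 2), 1 / 2 < ‖x‖ → ‖x‖ < 3 / 2 →
      Injective (mfderiv (𝓡 2) (𝓡 4) ψ x) := by
    intro x hx1 hx2
    have hx0 : x ≠ 0 := hA0 ⟨hx1, hx2⟩
    have h1 : MDifferentiableAt (𝓡 2) (𝓡 2) φ x :=
      ((hφs x hx0).contMDiffAt (isOpen_ne.mem_nhds hx0)).mdifferentiableAt (by simp)
    have h2 : MDifferentiableAt (𝓡 2) (𝓡 4) j (φ x) := (hjs _).mdifferentiableAt (by simp)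
    rw [show ψ = j ∘ φ from rfl, mfderiv_comp x h2 h1]
    exact (hjimm _).comp (hφimm x hx0)
  have hψF : ψ '' A ⊆ centralSurfaceSet T := by
    rintro _ ⟨x, -, rfl⟩
    exact hjF _
  -- the round circles
  have hnorm : ∀ {r : ℝ}, 0 < r → ∀ x : Metric.sphere (0 : EuclideanSpace ℝ (Fin 2)) 1,
      ‖r • (x : EuclideanSpace ℝ (Fin 2))‖ = r := fun hr x => by
    rw [norm_smul, Real.norm_of_nonneg hr.le, norm_eq_of_mem_sphere x, mul_one]
  have hψ₀ : ∀ u : Metric.sphere (0 : EuclideanSpace ℝ (Fin 2)) 1,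
      ψ ((1 : ℝ) • (u : EuclideanSpace ℝ (Fin 2))) = γ u := fun u => by
    show j (φ ((1 : ℝ) • (u : EuclideanSpace ℝ (Fin 2)))) = γ u
    rw [hφr 1 one_pos u, sub_self, zero_smul, hν0 u, hjγN u]
  have hψ₁ : ∀ u : Metric.sphere (0 : EuclideanSpace ℝ (Fin 2)) 1,
      ψ ((1 + δ) • (u : EuclideanSpace ℝ (Fin 2))) = j (ν (u, δ • e₁)) := fun u => by
    show j (φ ((1 + δ) • (u : EuclideanSpace ℝ (Fin 2)))) = _
    rw [hφr (1 + δ) (by linarith) u, add_sub_cancel_left]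
  have hmem₀ : ∀ u : Metric.sphere (0 : EuclideanSpace ℝ (Fin 2)) 1,
      (1 : ℝ) • (u : EuclideanSpace ℝ (Fin 2)) ∈ A := fun u => by
    simp only [hA_def, mem_setOf_eq, hnorm one_pos]; norm_num
  have hmem₁ : ∀ u : Metric.sphere (0 : EuclideanSpace ℝ (Fin 2)) 1,
      (1 + δ) • (u : EuclideanSpace ℝ (Fin 2)) ∈ A := fun u => by
    simp only [hA_def, mem_setOf_eq, hnorm (show (0 : ℝ) < 1 + δ by linarith)]
    constructor <;> linarith
  -- the push-off
  have hcurve : IsCurve T (range fun u : Metric.sphere (0 : EuclideanSpace ℝ (Fin 2)) 1 =>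
      ψ ((1 + δ) • (u : EuclideanSpace ℝ (Fin 2)))) :=
    helper_isCurve_roundCircle_of_annularChart M T ψ (1 / 2) (3 / 2) hψs hψinj hψimm hψF (1 + δ)
      (by linarith) (by linarith) (by linarith)
  refine ⟨range fun u : Metric.sphere (0 : EuclideanSpace ℝ (Fin 2)) 1 =>
      ψ ((1 + δ) • (u : EuclideanSpace ℝ (Fin 2))), hcurve, ?_, ?_,
    ψ, 1 / 2, 1, 1 + δ, 3 / 2, one_pos, by linarith, by norm_num, by linarith, by norm_num,
    by linarith, hψs, hψinj, hψimm, hψF, ?_, rfl⟩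
  · -- `c` and `c'` are disjoint
    refine Set.disjoint_left.2 fun z hz hz' => ?_
    rw [← hγc] at hz
    obtain ⟨u, rfl⟩ := hz
    obtain ⟨v, hv⟩ := hz'
    have heq : (1 + δ) • (v : EuclideanSpace ℝ (Fin 2)) =
        (1 : ℝ) • (u : EuclideanSpace ℝ (Fin 2)) :=
      hψinj (hmem₁ v) (hmem₀ u) (by rw [hψ₀ u]; exact hv)
    have := congrArg (fun w : EuclideanSpace ℝ (Fin 2) => ‖w‖) heq
    simp only [hnorm (show (0 : ℝ) < 1 + δ by linarith), hnorm one_pos] at this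
    linarith
  · -- `c' ⊆ U`
    rintro _ ⟨v, rfl⟩
    show ψ ((1 + δ) • (v : EuclideanSpace ℝ (Fin 2))) ∈ U
    rw [hψ₁ v]
    have he₁n : ‖e₁‖ = 1 := by simp [he₁]
    have hdist : dist (δ • e₁) (0 : EuclideanSpace ℝ (Fin 1)) < ε := by
      rw [dist_zero_right, norm_smul, he₁n, mul_one, Real.norm_of_nonneg hδpos.le]
      exact hδε
    exact hεU hdist v (mem_univ v)
  · -- the first round circle is `c`
    rw [← hγc]
    exact congrArg range (funext hψ₀)

end Summit.SmoothPoincare4.SmoothPoincare4.Theorems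

end
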